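import Mathlib
import Summits.Ventures.HodgeRepro.Tier4.Target
import Summits.Ventures.HodgeRepro.Tier4.Line3.KMDatum

/-!
# Tier4/Line3/KMDatumS — the sesquilinear archimedean `(1,0)`-datum of LINE L3 (Part I-b, v0.14 shape) and L3.e

Blind re-derivation cell `pub-hodge-repro`, Tier 4 «PROVE THE STEP» (README §9–§10), LINE L3, seat t4-L3-p1 (prover).
This module lands Part I-b of `Tier4/Line3/Skeleton.lean` in the FILED v0.14 shape (t4-plan-3, 5b774b9a…, L224–L277;
lead S12401) VERBATIM up to three renamings forced by the tree: the fully-qualified names `KMDatum`, `datum`,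
`datum_smul` are taken by the superseded conjugate-linear shape (`Tier4/Line3/KMDatum.lean`, p661716 — a blind seat
cannot retire a module), so the v0.14 objects are `KMDatumS`, `datumS`, `datumS_smul`.  The majorant `maj` is
byte-identical in both shapes and is IMPORTED from `Tier4/Line3/KMDatum.lean` (with `maj_smul` = v0.14's
`maj_smul_unit`).

The datum: `Φ(y, z)_k = (ȳ ⬝ A_k(z) y) · e^{−π (y,y)_z}` — a SESQUILINEAR form in `y` (bidegree `(1,1)`, scalar weight
`0`, the only weight compatible with the untwisted `U(2,1)`-equivariance `ThetaData.equiv`; the model example is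
`∂_{z_k} e^{−π maj}`), with coefficient matrices `A z k` continuous in `z` and of polynomial growth at `∂𝔹`, times the
Gaussian of the majorant.  L3.e: the datum is INVARIANT under the unit scalars (`datumS_smul`, proved).

Nothing here asserts anything about the truth of (P); HC_CM is NOT proved by anyone in this repository.
-/

set_option autoImplicit false

noncomputable section

namespace Summit.Ventures.HodgeRepro.Tier4.Line3

open Summit.Ventures.HodgeRepro.Tier4
open Matrix
open scoped ComplexConjugate

/-- Archimedean `(1,0)`-data of Kudla–Millson shape on the ball (v0.14): the `dz_k`-coefficient at `z` is the
sesquilinear form `ȳ ⬝ A_k(z) y` in `y` (bidegree `(1,1)`: the `K`-type of an invariant `(1,0)`-datum in the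
Schrödinger model `S(V_∞) ⊗ 𝔭⁺^*` is `std^* ⊗ d^{-1}` on the `ȳ'`-side times `d` on the `y₂`-side — `ȳ_k y₂ e^{−π|y|²}` at
the origin, which is `(2π)^{-1} ∂_{z_k} e^{−π maj}|_{z=0}`; the torus character of type `−1` at `τ₀`, Liu Lemma D.2(2),
sits in the coefficient side and is cancelled there by `χ_V`), continuous in `z` with polynomial growth at `∂𝔹`, times
the Gaussian of the majorant.  (The conjugate-LINEAR shape `ȳ ⬝ ℓ z k` of scalar weight `−1` is `KMDatum`.) -/
structure KMDatumS where
  /-- the coefficient matrices of the sesquilinear form: `Φ(y, z)_k = (ȳ ⬝ A z k y) · e^{−π (y,y)_z}` -/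
  A : (Fin 2 → ℂ) → Fin 2 → Matrix (Fin 3) (Fin 3) ℂ
  cont : ∀ k i j, ContinuousOn (fun z => A z k i j) ball
  /-- polynomial growth at the boundary -/
  growth : ∃ C m : ℝ, ∀ z ∈ ball, ∀ k i j, ‖A z k i j‖ ≤ C / (1 - nsq z) ^ m

/-- The datum `Φ(y, z)_k = (ȳ ⬝ A z k y) · e^{−π (y,y)_z}`. -/
def datumS (Φ : KMDatumS) (y : Fin 3 → ℂ) (z : Fin 2 → ℂ) (k : Fin 2) : ℂ :=
  (star y ⬝ᵥ (Φ.A z k *ᵥ y)) * ((Real.exp (-Real.pi * maj y z) : ℝ) : ℂ)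

/-- L3.e (support cut): the datum is INVARIANT under the unit scalars, `Φ(t y, z) = Φ(y, z)` for `|t| = 1` (the majorant
is invariant under unit scalars, the form is sesquilinear).  v0.14: scalar weight `0`. -/
theorem datumS_smul (Φ : KMDatumS) (t : ℂ) (ht : ‖t‖ = 1) (y : Fin 3 → ℂ) (z : Fin 2 → ℂ) (k : Fin 2) :
    datumS Φ (t • y) z k = datumS Φ y z k := by
  unfold datumS
  rw [maj_smul t ht, star_smul, Matrix.mulVec_smul, smul_dotProduct, dotProduct_smul, smul_eq_mul, smul_eq_mul,
    ← mul_assoc, Complex.star_def, Complex.conj_mul', ht]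
  simp

end Summit.Ventures.HodgeRepro.Tier4.Line3

end
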